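/-
Copyright: the b2b-balaban T⁴-continuum CRUX team, row NE7b leaf lineage `t4-ne7b-formalise-leaf-06` (gen 157). Project licence.
-/
import Summits.QuantumFields.BalabanUV.T4Continuum.Spine.NE7b.AugmentedHessianEquivalence
import Summits.QuantumFields.BalabanUV.T4Continuum.Spine.NE7b.QuadraticFibreMinimiser

/-!
# THE CHART LETTER IN THE ENERGY CURRENCY: for a form that is COERCIVE on the whole fine space, `γ₀‖v‖² ≤ Q v v`, and ANY section
# `S` of the blocking with energy `Q(Sk)(Sk) ≤ C‖k‖²`, the augmented Hessian's inverse has `‖T⁻¹(k,φ)‖ ≤ √(C∕γ₀)‖k‖ + γ₀⁻¹‖φ‖` —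
# no `‖S‖`, no `‖Q‖`; with `Q ≤ γ₁‖·‖²` and an isometric section the constant is `√(γ₁∕γ₀) + γ₀⁻¹`, the sandwich constants and
# nothing else (row NE7b, node U5c; leaf-03's AHE §4 + QFM `le_of_orthogonal_ker` BY NAME — both BUILT, fast lane; [folklore])

Cell `pub-balaban`, sub-cell `t4`, spine estimate NE7b (`T4WeightBudget.RelWeightBound`; the cell's OWN estimate — NOT PRINTED in
[Bałaban 1983–89], NOT PROVED).  Crux-route work under `Spine/NE7b/` by a row leaf (`t4-ne7b-formalise-leaf-06` gen 157) in the
hard-step cell under FREEZE (0)'s crux-prover clause; NOTHING of Bałaban's is named as a Lean object, valued or asserted; no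
`T4Continuum/Support` leaf typed; no `def`; zero `sorry`.  Imports (BY NAME, nothing restated): leaf-03's `…AugmentedHessianEquivalence`
(AHE §3 existence; §4 `fst_aug_symm`, `aug_symm_inl_orthogonal`, `norm_symm_inr_le`) and `…QuadraticFibreMinimiser` (QFM
`le_of_orthogonal_ker`: the `Q`-orthogonal fibre point has the least energy on its fibre).  Companion of this lineage's
`…ChartLetterTestSection` (CLTS: the KERNEL-coercive case `m‖κ‖² ≤ Qκκ` on `ker D` only — the convex window — where the `(k,0)` column
costs `‖S‖ + √(C∕m)` through THEC's Pythagoras): here `Q` is coercive on ALL of `E` (the SANDWICH regime `γ₀·P ≤ Q ≤ γ₁·P` read in the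
reference form's energy norm — HSMO ∕ HSRF's currency), and then the `(k,0)` column is bounded by its own energy with NO `‖S‖` term.

WHY.  In the reference's energy currency the interacting Hessian is globally coercive (`γ₀`) and bounded (`γ₁`); the `(k,0)` column
`h = T⁻¹(k,0)` of the augmented inverse is the `Q`-critical point of the fibre `D⁻¹k`, so by QFM it has the LEAST energy on that
fibre: `γ₀‖h‖² ≤ Q h h ≤ Q(Sk)(Sk) ≤ C‖k‖²` for every competitor section `S` — whence `‖h‖ ≤ √(C∕γ₀)‖k‖` with no reference to `‖S‖`
or `‖Q‖`; the `(0,φ)` column is AHE's Lax–Milgram column `≤ γ₀⁻¹‖φ‖`.  For an isometric section (the coarse space in the quotient ∕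
energy norm of the blocking) `C = γ₁`, so `‖T⁻¹‖ ≤ √(γ₁∕γ₀) + γ₀⁻¹`: read for a COMPOSITE blocking in its own quotient norm this is the
one-shot chart letter, uniform in the number of steps (the pricing desk's (d2), [NE7bREF-G99-WORD-HSRF]: «HSRF §4 ∘ HSGT §5»), and
sharper than CLTS's `1 + √(γ₁∕γ₀) + γ₀⁻¹` by the dropped `‖S‖`.

WHAT IS PROVED ([folklore]; `E` real inner-product (complete in §3), `F` real normed; `Q : E →L E →L ℝ` SYMMETRIC; `D : E →L F`;
`T` any equivalence with AHE's reading `hT`; `S : F →L E` a section):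
* §1 `sq_le_of_coercive` (bookkeeping: `γ₀‖h‖² ≤ a`, `0 < γ₀` ⟹ `‖h‖ ≤ √(a∕γ₀)`), **`norm_symm_inl_le_of_coercive`** (`γ₀‖v‖² ≤ Qvv` on
  `E`, `0 < γ₀` ⟹ `‖T⁻¹(k,0)‖ ≤ √(Q(Sk)(Sk)∕γ₀)` for EVERY section `S`), `norm_symm_inl_le_of_coercive'` (energy letter `Q(Sk)(Sk) ≤ C‖k‖²`,
  `0 ≤ C` ⟹ `‖T⁻¹(k,0)‖ ≤ √(C∕γ₀)‖k‖`).
* §2 **`norm_symm_le_of_coercive_columns`** (`‖T⁻¹ y‖ ≤ √(C∕γ₀)‖y.1‖ + γ₀⁻¹‖y.2‖`), **`norm_symm_le_of_coercive`** (`≤ (√(C∕γ₀) + γ₀⁻¹)‖y‖`).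
* §3 **`exists_augHessian_equiv_of_coercive`** (`E` complete ⟹ `∃ T`, `hT`, `‖T⁻¹ y‖ ≤ (√(C∕γ₀) + γ₀⁻¹)‖y‖`),
  **`exists_augHessian_equiv_of_sandwich_iso`** (`Qvv ≤ γ₁‖v‖²`, `0 ≤ γ₁`, `‖Sk‖ = ‖k‖` ⟹ constant `√(γ₁∕γ₀) + γ₀⁻¹`), `…_nnreal`
  (HSCR ∕ HSIS's `hN` VERBATIM for any `N ≥ √(γ₁∕γ₀) + γ₀⁻¹`).
* §4 toy.

NOT HERE (honest): the kernel-coercive (convex-window) case — CLTS; which norms make print's sections isometric (the currency junction,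
(A3) ∕ (A1c), NC-NE7b-α UNRULED); the radius recursion; anything of Bałaban's.  BY-NAME EFFECT ON THE WALL: NONE.  NE7b NOT PRINTED ∕
NOT PROVED; spine PROVED 0∕9; rung (B)+1 on a FINITE torus — NOT infinite volume, NOT the mass gap, NOT Clay.  HONEST DEPENDENCY:
continuum YM on T⁴ ⇐ BetaPertH ∧ nine spine estimates (0∕9 proved); BetaPertH ⇐ (D1) ∧ (D4) ∧ CAP+tail; G-an2-4 gates asym, D1 and
NE2∕3∕4.
-/

set_option autoImplicit false

noncomputable section

namespace Summit.QuantumFields.BalabanUV.T4Continuum.NE7b.ChartLetterSandwich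

open scoped NNReal
open Summit.QuantumFields.BalabanUV.T4Continuum.NE7b

variable {E F : Type*} [NormedAddCommGroup E] [InnerProductSpace ℝ E] [NormedAddCommGroup F] [NormedSpace ℝ F]
variable {Q : E →L[ℝ] E →L[ℝ] ℝ} {D : E →L[ℝ] F}

/-! ## §1. The `(k, 0)` column by its own energy -/

omit [InnerProductSpace ℝ E] [NormedAddCommGroup F] [NormedSpace ℝ F] in
/-- Bookkeeping: `γ₀‖h‖² ≤ a` with `0 < γ₀` gives `‖h‖ ≤ √(a∕γ₀)`. [folklore] -/
theorem norm_le_sqrt_of_coercive [NormedSpace ℝ E] {γ₀ a : ℝ} (hγ₀ : 0 < γ₀) (h : E) (hle : γ₀ * ‖h‖ ^ 2 ≤ a) :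
    ‖h‖ ≤ Real.sqrt (a / γ₀) := by
  have h1 : ‖h‖ ^ 2 ≤ a / γ₀ := by rw [le_div_iff₀ hγ₀]; linarith
  calc ‖h‖ = Real.sqrt (‖h‖ ^ 2) := (Real.sqrt_sq (norm_nonneg h)).symm
    _ ≤ Real.sqrt (a / γ₀) := Real.sqrt_le_sqrt h1

/-- **THE `(k, 0)` COLUMN BY ITS OWN ENERGY**: `Q` symmetric and `γ₀`-coercive on ALL of `E` (`0 < γ₀`), `T` reading the augmented
Hessian, `S` ANY section of `D` ⟹ `‖T⁻¹(k,0)‖ ≤ √(Q(Sk)(Sk)∕γ₀)` — the column is the `Q`-critical point of the fibre of `k` (AHE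
`fst_aug_symm` ∕ `aug_symm_inl_orthogonal`), so QFM `le_of_orthogonal_ker` gives `Q h h ≤ Q(Sk)(Sk)`, and coercivity converts energy to
norm.  No `‖S‖`, no `‖Q‖`. [folklore] -/
theorem norm_symm_inl_le_of_coercive (T : E ≃L[ℝ] F × (D.ker →L[ℝ] ℝ))
    (hT : ∀ h, T h = (D h, (Q h).comp D.ker.subtypeL)) (S : F →L[ℝ] E) (hS : ∀ k, D (S k) = k)
    (hsymm : ∀ u v, Q u v = Q v u) {γ₀ : ℝ} (hγ₀ : 0 < γ₀) (hco : ∀ v, γ₀ * ‖v‖ ^ 2 ≤ Q v v) (k : F) :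
    ‖T.symm (k, 0)‖ ≤ Real.sqrt (Q (S k) (S k) / γ₀) := by
  have hD : D (S k) = D (T.symm (k, 0)) := by
    rw [hS, AugmentedHessianEquivalence.fst_aug_symm T hT (k, 0)]
  have hmin : Q (T.symm (k, 0)) (T.symm (k, 0)) ≤ Q (S k) (S k) :=
    QuadraticFibreMinimiser.le_of_orthogonal_ker hsymm
      (fun κ _ => (mul_nonneg hγ₀.le (sq_nonneg ‖κ‖)).trans (hco κ)) hD
      (fun κ hκ => AugmentedHessianEquivalence.aug_symm_inl_orthogonal T hT k κ hκ)
  exact norm_le_sqrt_of_coercive hγ₀ _ ((hco _).trans hmin)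

/-- With the energy letter `Q(Sk)(Sk) ≤ C‖k‖²` (`0 ≤ C`): `‖T⁻¹(k,0)‖ ≤ √(C∕γ₀)·‖k‖`. [folklore] -/
theorem norm_symm_inl_le_of_coercive' (T : E ≃L[ℝ] F × (D.ker →L[ℝ] ℝ))
    (hT : ∀ h, T h = (D h, (Q h).comp D.ker.subtypeL)) (S : F →L[ℝ] E) (hS : ∀ k, D (S k) = k)
    (hsymm : ∀ u v, Q u v = Q v u) {γ₀ : ℝ} (hγ₀ : 0 < γ₀) (hco : ∀ v, γ₀ * ‖v‖ ^ 2 ≤ Q v v)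
    {C : ℝ} (hC0 : 0 ≤ C) (hC : ∀ k, Q (S k) (S k) ≤ C * ‖k‖ ^ 2) (k : F) :
    ‖T.symm (k, 0)‖ ≤ Real.sqrt (C / γ₀) * ‖k‖ := by
  refine (norm_symm_inl_le_of_coercive T hT S hS hsymm hγ₀ hco k).trans ?_
  rw [← Real.sqrt_sq (norm_nonneg k), ← Real.sqrt_mul (div_nonneg hC0 hγ₀.le)]
  exact Real.sqrt_le_sqrt (by rw [div_mul_eq_mul_div]; exact div_le_div_of_nonneg_right (hC k) hγ₀.le)

/-! ## §2. The whole inverse -/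

/-- **COLUMN BY COLUMN**: `‖T⁻¹ y‖ ≤ √(C∕γ₀)‖y.1‖ + γ₀⁻¹‖y.2‖` (§1 + AHE `norm_symm_inr_le` with `M := S`, the coercivity on `ker D`
being the restriction of the global one). [folklore] -/
theorem norm_symm_le_of_coercive_columns (T : E ≃L[ℝ] F × (D.ker →L[ℝ] ℝ))
    (hT : ∀ h, T h = (D h, (Q h).comp D.ker.subtypeL)) (S : F →L[ℝ] E) (hS : ∀ k, D (S k) = k)
    (hsymm : ∀ u v, Q u v = Q v u) {γ₀ : ℝ} (hγ₀ : 0 < γ₀) (hco : ∀ v, γ₀ * ‖v‖ ^ 2 ≤ Q v v)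
    {C : ℝ} (hC0 : 0 ≤ C) (hC : ∀ k, Q (S k) (S k) ≤ C * ‖k‖ ^ 2) (y : F × (D.ker →L[ℝ] ℝ)) :
    ‖T.symm y‖ ≤ Real.sqrt (C / γ₀) * ‖y.1‖ + γ₀⁻¹ * ‖y.2‖ := by
  have e : T.symm y = T.symm (y.1, 0) + T.symm (0, y.2) := by
    rw [← map_add, Prod.mk_add_mk, add_zero, zero_add]
  rw [e]
  exact (norm_add_le _ _).trans (add_le_add (norm_symm_inl_le_of_coercive' T hT S hS hsymm hγ₀ hco hC0 hC y.1)
    (AugmentedHessianEquivalence.norm_symm_inr_le hS hγ₀ (fun κ _ => hco κ) T hT y.2))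

/-- **THE CHART LETTER IN THE ENERGY CURRENCY**: `‖T⁻¹ y‖ ≤ (√(C∕γ₀) + γ₀⁻¹)‖y‖`. [folklore] -/
theorem norm_symm_le_of_coercive (T : E ≃L[ℝ] F × (D.ker →L[ℝ] ℝ))
    (hT : ∀ h, T h = (D h, (Q h).comp D.ker.subtypeL)) (S : F →L[ℝ] E) (hS : ∀ k, D (S k) = k)
    (hsymm : ∀ u v, Q u v = Q v u) {γ₀ : ℝ} (hγ₀ : 0 < γ₀) (hco : ∀ v, γ₀ * ‖v‖ ^ 2 ≤ Q v v)
    {C : ℝ} (hC0 : 0 ≤ C) (hC : ∀ k, Q (S k) (S k) ≤ C * ‖k‖ ^ 2) (y : F × (D.ker →L[ℝ] ℝ)) :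
    ‖T.symm y‖ ≤ (Real.sqrt (C / γ₀) + γ₀⁻¹) * ‖y‖ := by
  have h := norm_symm_le_of_coercive_columns T hT S hS hsymm hγ₀ hco hC0 hC y
  have h1 : ‖y.1‖ ≤ ‖y‖ := norm_fst_le y
  have h2 : ‖y.2‖ ≤ ‖y‖ := norm_snd_le y
  have hA : 0 ≤ Real.sqrt (C / γ₀) := Real.sqrt_nonneg _
  have hB : 0 ≤ γ₀⁻¹ := (inv_pos.mpr hγ₀).le
  calc ‖T.symm y‖ ≤ Real.sqrt (C / γ₀) * ‖y.1‖ + γ₀⁻¹ * ‖y.2‖ := h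
    _ ≤ Real.sqrt (C / γ₀) * ‖y‖ + γ₀⁻¹ * ‖y‖ :=
        add_le_add (mul_le_mul_of_nonneg_left h1 hA) (mul_le_mul_of_nonneg_left h2 hB)
    _ = (Real.sqrt (C / γ₀) + γ₀⁻¹) * ‖y‖ := by ring

/-! ## §3. The END in `…HardStepChartRadius`'s binder shape -/

/-- **THE EQUIVALENCE WITH THE ENERGY-CURRENCY CONSTANT**: `E` complete, `Q` symmetric and `γ₀`-coercive on `E`, `S` a section with
energy `≤ C‖k‖²` ⟹ `∃ T` reading `(D, Q)` with `‖T⁻¹ y‖ ≤ (√(C∕γ₀) + γ₀⁻¹)‖y‖`. [folklore] -/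
theorem exists_augHessian_equiv_of_coercive [CompleteSpace E] (S : F →L[ℝ] E) (hS : ∀ k, D (S k) = k)
    (hsymm : ∀ u v, Q u v = Q v u) {γ₀ : ℝ} (hγ₀ : 0 < γ₀) (hco : ∀ v, γ₀ * ‖v‖ ^ 2 ≤ Q v v)
    {C : ℝ} (hC0 : 0 ≤ C) (hC : ∀ k, Q (S k) (S k) ≤ C * ‖k‖ ^ 2) :
    ∃ T : E ≃L[ℝ] F × (D.ker →L[ℝ] ℝ),
      (∀ h, T h = (D h, (Q h).comp D.ker.subtypeL)) ∧ ∀ y, ‖T.symm y‖ ≤ (Real.sqrt (C / γ₀) + γ₀⁻¹) * ‖y‖ := by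
  obtain ⟨T, hT, -⟩ := AugmentedHessianEquivalence.exists_augHessian_equiv (Q := Q) hS hγ₀ (fun κ _ => hco κ)
  exact ⟨T, hT, norm_symm_le_of_coercive T hT S hS hsymm hγ₀ hco hC0 hC⟩

/-- **THE SANDWICH WITH AN ISOMETRIC SECTION**: `γ₀‖v‖² ≤ Qvv ≤ γ₁‖v‖²` (`0 < γ₀`, `0 ≤ γ₁`), `‖Sk‖ = ‖k‖` (the coarse space in the
quotient ∕ energy norm of `D`) ⟹ constant `√(γ₁∕γ₀) + γ₀⁻¹` — the sandwich constants and nothing else; for a composite blocking in its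
own quotient norm, the ONE-SHOT chart letter, uniform in the number of steps. [folklore] -/
theorem exists_augHessian_equiv_of_sandwich_iso [CompleteSpace E] (S : F →L[ℝ] E) (hS : ∀ k, D (S k) = k)
    (hSiso : ∀ k, ‖S k‖ = ‖k‖) (hsymm : ∀ u v, Q u v = Q v u) {γ₀ γ₁ : ℝ} (hγ₀ : 0 < γ₀) (hγ₁ : 0 ≤ γ₁)
    (hlo : ∀ v, γ₀ * ‖v‖ ^ 2 ≤ Q v v) (hhi : ∀ v, Q v v ≤ γ₁ * ‖v‖ ^ 2) :
    ∃ T : E ≃L[ℝ] F × (D.ker →L[ℝ] ℝ),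
      (∀ h, T h = (D h, (Q h).comp D.ker.subtypeL)) ∧ ∀ y, ‖T.symm y‖ ≤ (Real.sqrt (γ₁ / γ₀) + γ₀⁻¹) * ‖y‖ :=
  exists_augHessian_equiv_of_coercive S hS hsymm hγ₀ hlo hγ₁ fun k => by rw [← hSiso k]; exact hhi (S k)

/-- **THE SAME IN `ℝ≥0` CURRENCY** — HSCR ∕ HSIS's `hN` VERBATIM for any `N ≥ √(γ₁∕γ₀) + γ₀⁻¹`. [folklore] -/
theorem exists_augHessian_equiv_of_sandwich_iso_nnreal [CompleteSpace E] (S : F →L[ℝ] E) (hS : ∀ k, D (S k) = k)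
    (hSiso : ∀ k, ‖S k‖ = ‖k‖) (hsymm : ∀ u v, Q u v = Q v u) {γ₀ γ₁ : ℝ} (hγ₀ : 0 < γ₀) (hγ₁ : 0 ≤ γ₁)
    (hlo : ∀ v, γ₀ * ‖v‖ ^ 2 ≤ Q v v) (hhi : ∀ v, Q v v ≤ γ₁ * ‖v‖ ^ 2)
    {N : ℝ≥0} (hN : Real.sqrt (γ₁ / γ₀) + γ₀⁻¹ ≤ (N : ℝ)) :
    ∃ T : E ≃L[ℝ] F × (D.ker →L[ℝ] ℝ),
      (∀ h, T h = (D h, (Q h).comp D.ker.subtypeL)) ∧ ∀ y : F × (D.ker →L[ℝ] ℝ), ‖T.symm y‖ ≤ N * ‖y‖ := by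
  obtain ⟨T, hT, hb⟩ := exists_augHessian_equiv_of_sandwich_iso S hS hSiso hsymm hγ₀ hγ₁ hlo hhi
  exact ⟨T, hT, fun y => (hb y).trans (mul_le_mul_of_nonneg_right hN (norm_nonneg y))⟩

/-! ## §4. Toy -/

/-- Toy (the constant at the Gaussian point `γ₀ = γ₁ = 1` is `√1 + 1 = 2`). -/
example : Real.sqrt ((1 : ℝ) / 1) + (1 : ℝ)⁻¹ = 2 := by norm_num

/-! ## §5 (v1.1, append-only). THE SHARP CONSTANT BY PYTHAGORAS: the two columns are `Q`-orthogonal, so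
`‖T⁻¹(k,φ)‖ ≤ √((C‖k‖² + γ₀⁻¹‖φ‖²)∕γ₀) ≤ √(C∕γ₀ + γ₀⁻²)·‖(k,φ)‖` — `√2` at the Gaussian point `C = γ₀ = 1`, the pricing
desk's truth `‖T⁻¹‖ ∈ [1, √2]` ([NE7bREF-G99-WORD-HSRF]) at its upper end, against §2's `2` -/

section Sharp

variable {Q : E →L[ℝ] E →L[ℝ] ℝ} {D : E →L[ℝ] F}

/-- The `(0, φ)` column's ENERGY: `Q h₂ h₂ ≤ γ₀⁻¹‖φ‖²` for `h₂ = T⁻¹(0,φ)` (`Q h₂ h₂ = φ(h₂) ≤ ‖φ‖‖h₂‖` and `‖h₂‖ ≤ γ₀⁻¹‖φ‖`).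
[folklore] -/
theorem energy_symm_inr_le (T : E ≃L[ℝ] F × (D.ker →L[ℝ] ℝ)) (hT : ∀ h, T h = (D h, (Q h).comp D.ker.subtypeL))
    (S : F →L[ℝ] E) (hS : ∀ k, D (S k) = k) {γ₀ : ℝ} (hγ₀ : 0 < γ₀) (hco : ∀ v, γ₀ * ‖v‖ ^ 2 ≤ Q v v)
    (φ : D.ker →L[ℝ] ℝ) : Q (T.symm (0, φ)) (T.symm (0, φ)) ≤ γ₀⁻¹ * ‖φ‖ ^ 2 := by
  have hmem : T.symm (0, φ) ∈ D.ker := LinearMap.mem_ker.mpr (AugmentedHessianEquivalence.aug_symm_inr_mem_ker T hT φ)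
  have e : Q (T.symm (0, φ)) (T.symm (0, φ)) = φ ⟨T.symm (0, φ), hmem⟩ := by
    have h := AugmentedHessianEquivalence.snd_aug_symm T hT (0, φ)
    have h' := congrArg (fun L : D.ker →L[ℝ] ℝ => L ⟨T.symm (0, φ), hmem⟩) h
    simpa [AugmentedHessianEquivalence.comp_subtypeL_apply] using h'
  have h1 : ‖T.symm (0, φ)‖ ≤ γ₀⁻¹ * ‖φ‖ :=
    AugmentedHessianEquivalence.norm_symm_inr_le hS hγ₀ (fun κ _ => hco κ) T hT φ
  have h2 : φ ⟨T.symm (0, φ), hmem⟩ ≤ ‖φ‖ * ‖T.symm (0, φ)‖ := by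
    have := φ.le_opNorm ⟨T.symm (0, φ), hmem⟩
    rw [Real.norm_eq_abs] at this
    exact (le_abs_self _).trans (by simpa using this)
  rw [e]
  calc φ ⟨T.symm (0, φ), hmem⟩ ≤ ‖φ‖ * ‖T.symm (0, φ)‖ := h2
    _ ≤ ‖φ‖ * (γ₀⁻¹ * ‖φ‖) := mul_le_mul_of_nonneg_left h1 (norm_nonneg φ)
    _ = γ₀⁻¹ * ‖φ‖ ^ 2 := by ring

/-- **PYTHAGORAS FOR THE TWO COLUMNS**: `Q (T⁻¹(k,0)) (T⁻¹(0,φ)) = 0` — the `(k,0)` column is `Q`-orthogonal to `ker D` (AHE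
`aug_symm_inl_orthogonal`) and the `(0,φ)` column lies in `ker D` (AHE `aug_symm_inr_mem_ker`). [folklore] -/
theorem columns_orthogonal (T : E ≃L[ℝ] F × (D.ker →L[ℝ] ℝ)) (hT : ∀ h, T h = (D h, (Q h).comp D.ker.subtypeL))
    (k : F) (φ : D.ker →L[ℝ] ℝ) : Q (T.symm (k, 0)) (T.symm (0, φ)) = 0 :=
  AugmentedHessianEquivalence.aug_symm_inl_orthogonal T hT k _ (AugmentedHessianEquivalence.aug_symm_inr_mem_ker T hT φ)

/-- **THE SHARP CHART LETTER**: `Q` symmetric, `γ₀`-coercive on `E`, `S` any section with energy `≤ C‖k‖²` ⟹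
`‖T⁻¹ y‖ ≤ √((C‖y.1‖² + γ₀⁻¹‖y.2‖²)∕γ₀)` — the energies of the two `Q`-orthogonal columns ADD (no cross term), and global
coercivity converts the total energy into norm once. [folklore] -/
theorem norm_symm_le_of_coercive_sharp (T : E ≃L[ℝ] F × (D.ker →L[ℝ] ℝ))
    (hT : ∀ h, T h = (D h, (Q h).comp D.ker.subtypeL)) (S : F →L[ℝ] E) (hS : ∀ k, D (S k) = k)
    (hsymm : ∀ u v, Q u v = Q v u) {γ₀ : ℝ} (hγ₀ : 0 < γ₀) (hco : ∀ v, γ₀ * ‖v‖ ^ 2 ≤ Q v v)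
    {C : ℝ} (hC : ∀ k, Q (S k) (S k) ≤ C * ‖k‖ ^ 2) (y : F × (D.ker →L[ℝ] ℝ)) :
    ‖T.symm y‖ ≤ Real.sqrt ((C * ‖y.1‖ ^ 2 + γ₀⁻¹ * ‖y.2‖ ^ 2) / γ₀) := by
  have e : T.symm y = T.symm (y.1, 0) + T.symm (0, y.2) := by
    rw [← map_add, Prod.mk_add_mk, add_zero, zero_add]
  -- energy of the (k,0) column: the critical point of its fibre
  have hD : D (S y.1) = D (T.symm (y.1, 0)) := by
    rw [hS, AugmentedHessianEquivalence.fst_aug_symm T hT (y.1, 0)]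
  have h1 : Q (T.symm (y.1, 0)) (T.symm (y.1, 0)) ≤ C * ‖y.1‖ ^ 2 :=
    (QuadraticFibreMinimiser.le_of_orthogonal_ker hsymm (fun κ _ => (mul_nonneg hγ₀.le (sq_nonneg ‖κ‖)).trans (hco κ)) hD
      (fun κ hκ => AugmentedHessianEquivalence.aug_symm_inl_orthogonal T hT y.1 κ hκ)).trans (hC y.1)
  have h2 := energy_symm_inr_le T hT S hS hγ₀ hco y.2
  have horth := columns_orthogonal T hT y.1 y.2
  -- Pythagoras
  have hsum : Q (T.symm y) (T.symm y) = Q (T.symm (y.1, 0)) (T.symm (y.1, 0)) + Q (T.symm (0, y.2)) (T.symm (0, y.2)) := by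
    rw [e, map_add]
    simp only [add_apply, map_add]
    rw [horth, hsymm (T.symm (0, y.2)) (T.symm (y.1, 0)), horth]
    ring
  have htot : γ₀ * ‖T.symm y‖ ^ 2 ≤ C * ‖y.1‖ ^ 2 + γ₀⁻¹ * ‖y.2‖ ^ 2 := by
    have := hco (T.symm y); rw [hsum] at this; linarith
  exact norm_le_sqrt_of_coercive hγ₀ _ htot

/-- Real arithmetic: `√((C a² + g b²)∕γ₀) ≤ √(C∕γ₀ + g∕γ₀)·m` when `a, b ≤ m`, `0 ≤ C, g, m`, `0 < γ₀`. [folklore] -/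
theorem sqrt_weighted_le {C g γ₀ a b m : ℝ} (hγ₀ : 0 < γ₀) (hC : 0 ≤ C) (hg : 0 ≤ g) (hm : 0 ≤ m) (ha0 : 0 ≤ a) (hb0 : 0 ≤ b)
    (ha : a ≤ m) (hb : b ≤ m) :
    Real.sqrt ((C * a ^ 2 + g * b ^ 2) / γ₀) ≤ Real.sqrt (C / γ₀ + g / γ₀) * m := by
  rw [← Real.sqrt_sq hm, ← Real.sqrt_mul (by positivity)]
  apply Real.sqrt_le_sqrt
  have ha2 : a ^ 2 ≤ m ^ 2 := pow_le_pow_left₀ ha0 ha 2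
  have hb2 : b ^ 2 ≤ m ^ 2 := pow_le_pow_left₀ hb0 hb 2
  have key : C * a ^ 2 + g * b ^ 2 ≤ C * m ^ 2 + g * m ^ 2 :=
    add_le_add (mul_le_mul_of_nonneg_left ha2 hC) (mul_le_mul_of_nonneg_left hb2 hg)
  calc (C * a ^ 2 + g * b ^ 2) / γ₀ ≤ (C * m ^ 2 + g * m ^ 2) / γ₀ := div_le_div_of_nonneg_right key hγ₀.le
    _ = (C / γ₀ + g / γ₀) * m ^ 2 := by ring

/-- **THE SHARP CONSTANT IN OPERATOR FORM**: `‖T⁻¹ y‖ ≤ √(C∕γ₀ + γ₀⁻²)·‖y‖` (`0 ≤ C`; sup norm on the product) — `≤ √(C∕γ₀) + γ₀⁻¹`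
of §2, and `√2` instead of `2` at the Gaussian point. [folklore] -/
theorem norm_symm_le_of_coercive_sharp' (T : E ≃L[ℝ] F × (D.ker →L[ℝ] ℝ))
    (hT : ∀ h, T h = (D h, (Q h).comp D.ker.subtypeL)) (S : F →L[ℝ] E) (hS : ∀ k, D (S k) = k)
    (hsymm : ∀ u v, Q u v = Q v u) {γ₀ : ℝ} (hγ₀ : 0 < γ₀) (hco : ∀ v, γ₀ * ‖v‖ ^ 2 ≤ Q v v)
    {C : ℝ} (hC0 : 0 ≤ C) (hC : ∀ k, Q (S k) (S k) ≤ C * ‖k‖ ^ 2) (y : F × (D.ker →L[ℝ] ℝ)) :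
    ‖T.symm y‖ ≤ Real.sqrt (C / γ₀ + γ₀⁻¹ / γ₀) * ‖y‖ :=
  (norm_symm_le_of_coercive_sharp T hT S hS hsymm hγ₀ hco hC y).trans
    (sqrt_weighted_le hγ₀ hC0 (inv_pos.mpr hγ₀).le (norm_nonneg y) (norm_nonneg y.1) (norm_nonneg y.2) (norm_fst_le y)
      (norm_snd_le y))

/-- **THE SHARP EQUIVALENCE** (`E` complete): `∃ T` reading `(D, Q)` with `‖T⁻¹ y‖ ≤ √(C∕γ₀ + γ₀⁻¹∕γ₀)·‖y‖`; with an isometric section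
and `Q ≤ γ₁‖·‖²` the constant is `√(γ₁∕γ₀ + γ₀⁻²)` — HSCR's `hN` for any `N` above it. [folklore] -/
theorem exists_augHessian_equiv_of_coercive_sharp [CompleteSpace E] (S : F →L[ℝ] E) (hS : ∀ k, D (S k) = k)
    (hsymm : ∀ u v, Q u v = Q v u) {γ₀ : ℝ} (hγ₀ : 0 < γ₀) (hco : ∀ v, γ₀ * ‖v‖ ^ 2 ≤ Q v v)
    {C : ℝ} (hC0 : 0 ≤ C) (hC : ∀ k, Q (S k) (S k) ≤ C * ‖k‖ ^ 2)
    {N : ℝ≥0} (hN : Real.sqrt (C / γ₀ + γ₀⁻¹ / γ₀) ≤ (N : ℝ)) :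
    ∃ T : E ≃L[ℝ] F × (D.ker →L[ℝ] ℝ),
      (∀ h, T h = (D h, (Q h).comp D.ker.subtypeL)) ∧ ∀ y : F × (D.ker →L[ℝ] ℝ), ‖T.symm y‖ ≤ N * ‖y‖ := by
  obtain ⟨T, hT, -⟩ := AugmentedHessianEquivalence.exists_augHessian_equiv (Q := Q) hS hγ₀ (fun κ _ => hco κ)
  exact ⟨T, hT, fun y => (norm_symm_le_of_coercive_sharp' T hT S hS hsymm hγ₀ hco hC0 hC y).trans
    (mul_le_mul_of_nonneg_right hN (norm_nonneg y))⟩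

/-- Toy: at the Gaussian point `C = γ₀ = 1` the sharp constant is `√2` (§2's is `2`). -/
example : Real.sqrt ((1 : ℝ) / 1 + (1 : ℝ)⁻¹ / 1) = Real.sqrt 2 := by norm_num

end Sharp

end Summit.QuantumFields.BalabanUV.T4Continuum.NE7b.ChartLetterSandwich

end
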